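import Summits.ValiantsHypothesis.ValiantsHypothesis.Theorems.NewtonTauWeak.Negative.Zonogon

/-!
# `NewtonTauWeak` (stmt-ValiantsHypothesis-5904) — block transfer: the crux bounds the Newton polygons of
# entries of short matrix products (negative lane, part 3: the formal KILL TARGET)

From the standing disprover's `Cruxes/NewtonTauWeak/Disproof.lean` §D (note N2 made formal).  KPTT prove
(arXiv:1308.2286 Thm 1) that their conjecture gives circuit lower bounds through depth reduction; the
elementary core of that transfer needs no depth reduction at all: an entry of a product of `ℓ = m·B`
matrices of size `w` whose entries are `t`-sparse bivariate polynomials is, after grouping into `m` blocks,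
a sum of `w^{m+1}` products of `m` block entries, each `w^{B+1} t^B`-sparse (`list_prod_ofFn_apply`,
`card_support_pathSum_le`, `list_prod_ofFn_blocks`).  Hence

* `vert_matrixProd_le_of_newtonTauWeak` — `NewtonTauWeak →` every such entry has
  `vert ≤ 2^{a m} (w^{m+1}·(w^{B+1} t^B) + 2)^b`; with `B = m = √ℓ` this is `2^{O(√ℓ·log(w t))}`.

So a family of products of `ℓ` matrices of bounded size with signed-MONOMIAL entries (`t = 1`, even
`w = 2`; `w = 3` already simulates all formulas by Ben-Or–Cleve) whose entries have `2^{ω(√ℓ)}` Newton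
vertices would REFUTE the crux — a concrete, fully formal target for refuters; without cancellation the
truth is `poly(ℓ)` for bounded `w` (parametric shortest paths in bounded-width layered graphs), and no
construction beating it is known.  Conclusion is not a route statement (consequence of the crux only).
[folklore]
-/

set_option linter.dupNamespace false

namespace Summit.ValiantsHypothesis.ValiantsHypothesis.Theorems.NewtonTauWeak.Negative

open scoped BigOperators
open MvPolynomial Finset
open Summit.ValiantsHypothesis.ValiantsHypothesis.Theses.NewtonUnitEquations (NewtonTauWeak)

noncomputable section

/-! ## §D Block transfer (note N2 made formal): the crux bounds the Newton polygons of entries of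
short matrix products — KILL TARGET T2

`vert_matrixProd_le_of_newtonTauWeak`: under the crux, every entry of a product of `m·B` matrices of
size `w` with `t`-sparse bivariate entries has at most `2^{a m}(w^{m+1}·w^{B+1} t^B + 2)^b` Newton
vertices.  So a family of such products (even `w = 2`, signed monomial entries, `B = m = √ℓ`) with
`2^{ω(√ℓ·log(wt))}` vertices REFUTES the crux; nothing is known beyond `poly(ℓ)` (no cancellation). -/

section MatrixTransfer

open scoped Pointwise

variable {R : Type*} [CommSemiring R] {w : ℕ}

/-- Path-sum expansion of an entry of a product of `m` square matrices: sum over state sequences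
`s : Fin (m+1) → Fin w` pinned at both ends. -/
def pathSum (m : ℕ) (N : Fin m → Matrix (Fin w) (Fin w) R) (x y : Fin w) : R :=
  ∑ s : Fin (m + 1) → Fin w,
    if s 0 = x ∧ s (Fin.last m) = y then ∏ j : Fin m, N j (s j.castSucc) (s j.succ) else 0

/-- `(N₀ ⋯ N_{m-1}) x y = Σ_{s, s₀ = x, s_m = y} Π_j N_j (s_j) (s_{j+1})`. -/
theorem list_prod_ofFn_apply (m : ℕ) (N : Fin m → Matrix (Fin w) (Fin w) R) (x y : Fin w) :
    (List.ofFn N).prod x y = pathSum m N x y := by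
  classical
  induction m generalizing x with
  | zero =>
    rw [List.ofFn_zero, List.prod_nil, Matrix.one_apply, pathSum]
    rw [← (Fin.consEquiv fun _ : Fin 1 => Fin w).sum_comp, Fintype.sum_prod_type]
    simp only [Finset.univ_unique, Finset.sum_singleton, Fin.prod_univ_zero]
    have h0 : ∀ a : Fin w, ((Fin.consEquiv fun _ : Fin 1 => Fin w) (a, default)) 0 = a := fun a => rfl
    have hl : (Fin.last 0) = 0 := rfl
    simp_rw [hl, h0, ite_and]
    rw [Finset.sum_ite_eq' Finset.univ x]
    simp
  | succ m ih =>
    rw [List.ofFn_succ, List.prod_cons, Matrix.mul_apply]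
    simp_rw [ih]
    -- expand the right-hand side along the first state
    rw [pathSum, ← (Fin.consEquiv fun _ : Fin (m + 2) => Fin w).sum_comp, Fintype.sum_prod_type]
    have hcons : ∀ (a : Fin w) (s' : Fin (m + 1) → Fin w),
        (Fin.consEquiv (fun _ : Fin (m + 2) => Fin w)) (a, s') = Fin.cons a s' := fun _ _ => rfl
    simp_rw [hcons]
    have hlast : ∀ (a : Fin w) (s' : Fin (m + 1) → Fin w),
        (Fin.cons a s' : Fin (m + 2) → Fin w) (Fin.last (m + 1)) = s' (Fin.last m) := by
      intro a s'
      rw [← Fin.succ_last, Fin.cons_succ]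
    have hprod : ∀ (a : Fin w) (s' : Fin (m + 1) → Fin w),
        (∏ j : Fin (m + 1), N j ((Fin.cons a s' : Fin (m + 2) → Fin w) j.castSucc)
            ((Fin.cons a s' : Fin (m + 2) → Fin w) j.succ)) =
          N 0 a (s' 0) * ∏ j : Fin m, N j.succ (s' j.castSucc) (s' j.succ) := by
      intro a s'
      have h2 : (∏ j : Fin m, N j.succ ((Fin.cons a s' : Fin (m + 2) → Fin w) j.succ.castSucc)
            ((Fin.cons a s' : Fin (m + 2) → Fin w) j.succ.succ)) =
          ∏ j : Fin m, N j.succ (s' j.castSucc) (s' j.succ) :=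
        Finset.prod_congr rfl fun j _ => by rw [← Fin.succ_castSucc, Fin.cons_succ, Fin.cons_succ]
      rw [Fin.prod_univ_succ, Fin.castSucc_zero, Fin.cons_zero, Fin.cons_succ, h2]
    simp_rw [hlast, hprod]
    have hzero : ∀ (a : Fin w) (s' : Fin (m + 1) → Fin w),
        (Fin.cons a s' : Fin (m + 2) → Fin w) 0 = a := fun a s' => rfl
    simp_rw [hzero]
    -- sum over the first state `a`: only `a = x` survives
    have hsuma : ∀ s' : Fin (m + 1) → Fin w,
        (∑ a : Fin w, if a = x ∧ s' (Fin.last m) = y then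
            N 0 a (s' 0) * ∏ j : Fin m, N j.succ (s' j.castSucc) (s' j.succ) else 0) =
          if s' (Fin.last m) = y then
            N 0 x (s' 0) * ∏ j : Fin m, N j.succ (s' j.castSucc) (s' j.succ) else 0 := by
      intro s'
      simp_rw [ite_and]
      rw [Finset.sum_ite_eq' Finset.univ x]
      simp
    rw [Finset.sum_comm]
    simp_rw [hsuma]
    -- left-hand side: push the factor inside and sum over the first state of `s'`
    simp_rw [pathSum, Finset.mul_sum, mul_ite, mul_zero]
    rw [Finset.sum_comm]
    refine Finset.sum_congr rfl fun s' _ => ?_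
    simp_rw [ite_and]
    rw [Finset.sum_ite_eq Finset.univ (s' 0)]
    simp

/-- Sparsity bookkeeping: the support of a product has at most the product of the support sizes. -/
theorem card_support_prod_le {ι : Type*} (s : Finset ι) (g : ι → MvPolynomial (Fin 2) ℂ) :
    (∏ i ∈ s, g i).support.card ≤ ∏ i ∈ s, (g i).support.card := by
  classical
  induction s using Finset.induction_on with
  | empty =>
    simp only [Finset.prod_empty]
    exact (Finset.card_le_card support_one.subset).trans (by simp)
  | insert a s ha ih =>
    rw [Finset.prod_insert ha, Finset.prod_insert ha]
    calc ((g a) * ∏ i ∈ s, g i).support.card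
        ≤ ((g a).support + (∏ i ∈ s, g i).support).card := Finset.card_le_card (support_mul _ _)
      _ ≤ (g a).support.card * (∏ i ∈ s, g i).support.card := Finset.card_add_le
      _ ≤ (g a).support.card * ∏ i ∈ s, (g i).support.card := Nat.mul_le_mul_left _ ih

/-- Sparsity bookkeeping: the support of a sum has at most the sum of the support sizes. -/
theorem card_support_sum_le {ι : Type*} (s : Finset ι) (g : ι → MvPolynomial (Fin 2) ℂ) :
    (∑ i ∈ s, g i).support.card ≤ ∑ i ∈ s, (g i).support.card := by
  classical
  exact (Finset.card_le_card support_sum).trans Finset.card_biUnion_le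

/-- A path sum of `B` matrices with `t`-sparse entries is `w^{B+1} t^B`-sparse. -/
theorem card_support_pathSum_le (B t : ℕ) (N : Fin B → Matrix (Fin w) (Fin w) (MvPolynomial (Fin 2) ℂ))
    (hN : ∀ j u v, (N j u v).support.card ≤ t) (x y : Fin w) :
    (pathSum B N x y).support.card ≤ w ^ (B + 1) * t ^ B := by
  classical
  unfold pathSum
  refine (card_support_sum_le _ _).trans ?_
  have hterm : ∀ s : Fin (B + 1) → Fin w,
      (if s 0 = x ∧ s (Fin.last B) = y then ∏ j : Fin B, N j (s j.castSucc) (s j.succ) else 0).support.card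
        ≤ t ^ B := by
    intro s
    split_ifs
    · refine (card_support_prod_le _ _).trans ?_
      calc ∏ j : Fin B, (N j (s j.castSucc) (s j.succ)).support.card ≤ ∏ _j : Fin B, t :=
            Finset.prod_le_prod' fun j _ => hN j _ _
        _ = t ^ B := by simp
    · simp
  calc ∑ s : Fin (B + 1) → Fin w,
        (if s 0 = x ∧ s (Fin.last B) = y then ∏ j : Fin B, N j (s j.castSucc) (s j.succ) else 0).support.card
      ≤ ∑ _s : Fin (B + 1) → Fin w, t ^ B := Finset.sum_le_sum fun s _ => hterm s
    _ = w ^ (B + 1) * t ^ B := by simp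

/-- The `i`-th block of `B` consecutive factors of a family indexed by `Fin (m·B)`. -/
def blockFn {X : Type*} (m B : ℕ) (M : Fin (m * B) → X) (i : Fin m) : Fin B → X := fun j =>
  M ⟨i * B + j, by
    calc (i : ℕ) * B + j < i * B + B := by have := j.isLt; omega
      _ = (i + 1) * B := by ring
      _ ≤ m * B := Nat.mul_le_mul_right _ (by have := i.isLt; omega)⟩

/-- Blocks: the product of `m·B` matrices is the product of the `m` block products. -/
theorem list_prod_ofFn_blocks (m B : ℕ) (M : Fin (m * B) → Matrix (Fin w) (Fin w) R) :
    (List.ofFn M).prod = (List.ofFn fun i : Fin m => (List.ofFn (blockFn m B M i)).prod).prod := by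
  rw [List.ofFn_mul, List.prod_flatten, List.map_ofFn]
  rfl

/-- **N2 made formal.**  Under the crux, an entry of a product of `ℓ = m·B` matrices of size `w` with
`t`-sparse bivariate entries has at most `2^{a m} (w^{m+1} · (w^{B+1} t^B) + 2)^b` Newton-polygon
vertices (it is a sum of `w^{m+1}` products of `m` block entries, each `w^{B+1}t^B`-sparse).  With
`B = m = √ℓ` this is `2^{O(√ℓ · log(w t))}`: a family of products of `2 × 2` signed-monomial matrices whose
entries have `2^{ω(√ℓ)}` vertices would refute `NewtonTauWeak` (kill target T2 of note N2). -/
theorem vert_matrixProd_le_of_newtonTauWeak (h : NewtonTauWeak) :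
    ∃ a b : ℕ, ∀ (w m B t : ℕ) (M : Fin (m * B) → Matrix (Fin w) (Fin w) (MvPolynomial (Fin 2) ℂ)),
      (∀ i u v, (M i u v).support.card ≤ t) → ∀ x y : Fin w,
        vert ((List.ofFn M).prod x y) ≤ 2 ^ (a * m) * (w ^ (m + 1) * (w ^ (B + 1) * t ^ B) + 2) ^ b := by
  classical
  obtain ⟨a, b, hab⟩ := h
  refine ⟨a, b, fun w m B t M hM x y => ?_⟩
  -- block products and their sparsity
  let N : Fin m → Matrix (Fin w) (Fin w) (MvPolynomial (Fin 2) ℂ) := fun i =>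
    (List.ofFn (blockFn m B M i)).prod
  have hNdef : ∀ i, N i = (List.ofFn (blockFn m B M i)).prod := fun i => rfl
  have hNsparse : ∀ i u v, (N i u v).support.card ≤ w ^ (B + 1) * t ^ B := by
    intro i u v
    rw [hNdef, list_prod_ofFn_apply]
    exact card_support_pathSum_le B t _ (fun j u v => hM _ u v) u v
  have hprod : (List.ofFn M).prod x y = pathSum m N x y := by
    rw [list_prod_ofFn_blocks m B M, list_prod_ofFn_apply]
  -- the case `m = 0`: the product is `1`, at most one vertex
  rcases Nat.eq_zero_or_pos m with hm | hm
  · subst hm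
    have h1 : vert ((List.ofFn M).prod x y) ≤ 1 := by
      refine (vert_le_card_support _).trans ?_
      have : (List.ofFn M).prod x y = (1 : Matrix (Fin w) (Fin w) (MvPolynomial (Fin 2) ℂ)) x y := by
        rw [hprod, ← list_prod_ofFn_apply, List.ofFn_zero, List.prod_nil]
      rw [this, Matrix.one_apply]
      split_ifs
      · exact (Finset.card_le_card support_one.subset).trans (by simp)
      · simp
    calc vert ((List.ofFn M).prod x y) ≤ 1 := h1
      _ ≤ 2 ^ (a * 0) * (w ^ (0 + 1) * (w ^ (B + 1) * t ^ B) + 2) ^ b := by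
          rw [Nat.mul_zero, pow_zero, one_mul]
          exact Nat.one_le_pow _ _ (by omega)
  -- `m ≥ 1`: present the path sum in the crux's `Σ_{i<k} Π_{j<m}` shape, `k = w^{m+1}`
  haveI : NeZero m := ⟨by omega⟩
  let e : Fin (w ^ (m + 1)) ≃ (Fin (m + 1) → Fin w) := finFunctionFinEquiv.symm
  let F : (Fin (m + 1) → Fin w) → Fin m → MvPolynomial (Fin 2) ℂ := fun s j =>
    if (j : ℕ) = 0 ∧ ¬ (s 0 = x ∧ s (Fin.last m) = y) then 0 else N j (s j.castSucc) (s j.succ)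
  have hF : ∀ s, (∏ j : Fin m, F s j) =
      if s 0 = x ∧ s (Fin.last m) = y then ∏ j : Fin m, N j (s j.castSucc) (s j.succ) else 0 := by
    intro s
    by_cases hc : s 0 = x ∧ s (Fin.last m) = y
    · rw [if_pos hc]
      refine Finset.prod_congr rfl fun j _ => ?_
      simp [F, hc]
    · rw [if_neg hc]
      apply Finset.prod_eq_zero (Finset.mem_univ (0 : Fin m))
      simp [F, hc]
  have hFsparse : ∀ s j, (F s j).support.card ≤ w ^ (B + 1) * t ^ B := by
    intro s j
    simp only [F]
    split_ifs
    · simp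
    · exact hNsparse _ _ _
  have hshape : (∑ i : Fin (w ^ (m + 1)), ∏ j : Fin m, F (e i) j) = pathSum m N x y := by
    rw [e.sum_comp (fun s => ∏ j : Fin m, F s j)]
    simp_rw [hF]
    rfl
  have := hab (w ^ (m + 1)) m (w ^ (B + 1) * t ^ B) (fun i j => F (e i) j) (fun i j => hFsparse _ _)
  change vert (∑ i : Fin (w ^ (m + 1)), ∏ j : Fin m, F (e i) j) ≤ _ at this
  rw [hshape, ← hprod] at this
  exact this

/-- **Kill target T2 in its simplest dress.**  Under the crux there is a constant `c` such that every entry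
of a product of `m²` signed-MONOMIAL `2 × 2` matrices (entries with at most one monomial) has at most
`2^{c(m+1)}` Newton-polygon vertices — i.e. `2^{O(√ℓ)}` for length `ℓ`.  A family beating every such
`c` refutes `NewtonTauWeak`. -/
theorem vert_twoByTwo_monomialProd_le_of_newtonTauWeak (h : NewtonTauWeak) :
    ∃ c : ℕ, ∀ (m : ℕ) (M : Fin (m * m) → Matrix (Fin 2) (Fin 2) (MvPolynomial (Fin 2) ℂ)),
      (∀ i u v, (M i u v).support.card ≤ 1) → ∀ x y : Fin 2,
        vert ((List.ofFn M).prod x y) ≤ 2 ^ (c * (m + 1)) := by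
  obtain ⟨a, b, hab⟩ := vert_matrixProd_le_of_newtonTauWeak h
  refine ⟨a + 3 * b, fun m M hM x y => (hab 2 m m 1 M hM x y).trans ?_⟩
  have h1 : 2 ^ (m + 1) * (2 ^ (m + 1) * 1 ^ m) + 2 ≤ 2 ^ (2 * m + 3) := by
    rw [one_pow, mul_one, ← pow_add]
    have : 2 ≤ 2 ^ (m + 1 + (m + 1)) := by
      calc (2 : ℕ) = 2 ^ 1 := by norm_num
        _ ≤ 2 ^ (m + 1 + (m + 1)) := Nat.pow_le_pow_right (by norm_num) (by omega)
    calc 2 ^ (m + 1 + (m + 1)) + 2 ≤ 2 ^ (m + 1 + (m + 1)) + 2 ^ (m + 1 + (m + 1)) := by omega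
      _ = 2 ^ (2 * m + 3) := by rw [← two_mul, ← pow_succ']; ring_nf
  calc 2 ^ (a * m) * (2 ^ (m + 1) * (2 ^ (m + 1) * 1 ^ m) + 2) ^ b
      ≤ 2 ^ (a * m) * (2 ^ (2 * m + 3)) ^ b :=
        Nat.mul_le_mul_left _ (Nat.pow_le_pow_left h1 b)
    _ = 2 ^ (a * m + b * (2 * m + 3)) := by rw [← pow_mul, ← pow_add]; ring_nf
    _ ≤ 2 ^ ((a + 3 * b) * (m + 1)) := Nat.pow_le_pow_right (by norm_num) (by nlinarith)

end MatrixTransfer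

end

end Summit.ValiantsHypothesis.ValiantsHypothesis.Theorems.NewtonTauWeak.Negative
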